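import Mathlib.LinearAlgebra.Matrix.PosDef
import HarnessLib

/-!
# PSD witness for a block with a KNOWN kernel vector: delete one index, certify the principal submatrix

The «face block» step of an exact SDP upper-bound certificate (certsdp-primal/1, FORMAT-primal1 §S2; certnum
STEP-11): a real symmetric block `M = M_k(y*)` whose STRUCTURAL kernel vector `u` (with `M u = 0`) is known
exactly is positive semidefinite as soon as ONE principal submatrix is — the one obtained by deleting a single
index `j` with `u j ≠ 0`.  This lets a producer certify such a block by the ordinary Cholesky-residual witness
on the `(n-1) × (n-1)` remainder (`Literature.Analysis.InnerProduct.posSemidef_add_of_residual_le_rowSum`,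
file `CholeskyResidualEigenvalueBounds.lean`) instead of an exact `LDLᵀ` over `ℚ` of the whole dense block
(the step that does not finish at `n = 400`), and a reader replays it with the routine it already uses plus one
exact matrix–vector product.  Elementary linear algebra; the `k`-vector version iterates it.

Main result: `posSemidef_of_mulVec_eq_zero_of_posSemidef_submatrix_erase` (the congruence observation of
Horn–Johnson, Observation 7.1.8, in the coordinate form a certificate reader replays).
-/

namespace Literature.Computation.Certificates

open Matrix

variable {n : Type*} [Fintype n] [DecidableEq n]

/-- The quadratic form of a real matrix `M` at a vector `w` that VANISHES at index `j` equals the quadratic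
form of the principal submatrix of `M` with row and column `j` deleted, at the restriction of `w`. [folklore] -/
private theorem dotProduct_mulVec_eq_submatrix_of_apply_eq_zero (M : Matrix n n ℝ) {w : n → ℝ} {j : n}
    (hwj : w j = 0) :
    w ⬝ᵥ (M *ᵥ w) =
      (fun i : {i // i ≠ j} => w i) ⬝ᵥ
        ((M.submatrix (Subtype.val : {i // i ≠ j} → n) (Subtype.val : {i // i ≠ j} → n)) *ᵥ
          fun i : {i // i ≠ j} => w i) := by
  classical
  -- a sum over `n` whose `j`-th term vanishes is the sum over the subtype `{i // i ≠ j}`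
  have drop : ∀ g : n → ℝ, g j = 0 → (∑ i, g i) = ∑ i : {i // i ≠ j}, g i := by
    intro g hg
    rw [← Finset.add_sum_erase Finset.univ g (Finset.mem_univ j), hg, zero_add]
    exact Finset.sum_subtype (Finset.univ.erase j) (fun i => by simp [Finset.mem_erase]) g
  simp only [dotProduct, mulVec, submatrix_apply]
  rw [drop (fun i => w i * ∑ k, M i k * w k) (by rw [hwj, zero_mul])]
  refine Finset.sum_congr rfl fun i _ => ?_
  rw [drop (fun k => M (i : n) k * w k) (by rw [hwj, mul_zero])]

/-- **Face-block witness (one kernel vector).**  Let `M` be a real Hermitian (= symmetric) matrix with a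
known kernel vector `u`, `M *ᵥ u = 0`, and let `j` be an index with `u j ≠ 0`.  If the principal submatrix
of `M` obtained by deleting row and column `j` is positive semidefinite, then `M` is positive semidefinite.
Proof: for any `x` put `w := x - (x j / u j) • u`; then `w j = 0`, `M *ᵥ w = M *ᵥ x`, and by symmetry
`xᵀ M x = wᵀ M w`, which is the deleted submatrix's quadratic form at `w|_{i ≠ j}`.  This is the soundness
statement behind the certsdp-primal/1 witness mode «chol-residual-face» proposed in certnum STEP-11
(certify the `(n-1) × (n-1)` remainder by the ordinary Cholesky-residual inequality).  It is the instance
`C := (x ↦ w|_{i ≠ j})` of the congruence observation «`A ⪰ 0 ⇒ C*AC ⪰ 0`» applied to `A := M_{-j}`, since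
`xᵀ M x = (Cx)ᵀ M_{-j} (Cx)` for every `x` — we prove that identity directly.
[cite: HornJohnson2013, Observation 7.1.8] -/
theorem posSemidef_of_mulVec_eq_zero_of_posSemidef_submatrix_erase {M : Matrix n n ℝ}
    (hM : M.IsHermitian) {u : n → ℝ} (hu : M *ᵥ u = 0) {j : n} (hj : u j ≠ 0)
    (hsub : (M.submatrix (Subtype.val : {i // i ≠ j} → n) (Subtype.val : {i // i ≠ j} → n)).PosSemidef) :
    M.PosSemidef := by
  classical
  have hT : Mᵀ = M := by
    have h := hM
    rw [Matrix.IsHermitian, Matrix.conjTranspose_eq_transpose_of_trivial] at h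
    exact h
  refine Matrix.PosSemidef.of_dotProduct_mulVec_nonneg hM fun x => ?_
  -- the shifted vector
  set c : ℝ := x j / u j with hc
  set w : n → ℝ := x - c • u with hw
  have hwj : w j = 0 := by
    simp only [hw, hc, Pi.sub_apply, Pi.smul_apply, smul_eq_mul]
    rw [div_mul_cancel₀ _ hj, sub_self]
  have hMw : M *ᵥ w = M *ᵥ x := by
    simp only [hw, Matrix.mulVec_sub, Matrix.mulVec_smul, hu, smul_zero, sub_zero]
  -- symmetry: u ⬝ᵥ (M *ᵥ v) = 0 for every v
  have huM : ∀ v : n → ℝ, u ⬝ᵥ (M *ᵥ v) = 0 := by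
    intro v
    rw [Matrix.dotProduct_mulVec, ← Matrix.mulVec_transpose, hT, hu, zero_dotProduct]
  have hx : x = w + c • u := by
    simp only [hw]; abel
  have hquad : x ⬝ᵥ (M *ᵥ x) = w ⬝ᵥ (M *ᵥ w) := by
    calc x ⬝ᵥ (M *ᵥ x) = x ⬝ᵥ (M *ᵥ w) := by rw [hMw]
      _ = (w + c • u) ⬝ᵥ (M *ᵥ w) := by rw [← hx]
      _ = w ⬝ᵥ (M *ᵥ w) + c * (u ⬝ᵥ (M *ᵥ w)) := by rw [add_dotProduct, smul_dotProduct, smul_eq_mul]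
      _ = w ⬝ᵥ (M *ᵥ w) := by rw [huM, mul_zero, add_zero]
  have hstar : star x = x := by ext i; simp
  rw [hstar, hquad, dotProduct_mulVec_eq_submatrix_of_apply_eq_zero M hwj]
  have h := hsub.dotProduct_mulVec_nonneg (fun i : {i // i ≠ j} => w i)
  have hstar' : star (fun i : {i // i ≠ j} => w (i : n)) = fun i : {i // i ≠ j} => w (i : n) := by
    ext i; simp
  rwa [hstar'] at h

-- (The converse — every principal submatrix of a PSD matrix is PSD, which the producer uses to PICK `j` — is
-- Mathlib's `Matrix.PosSemidef.submatrix`.)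

end Literature.Computation.Certificates
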